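import Literature.Geometry.Riemannian.CurvatureFamilyBounds
import HarnessLib

/-!
# Point picking for a maximal Ricci flow with curvature blow-up

Stub `stub_pointPicking` of line `ancient-sphere-rigidity` for the crux
`EntropyRung.SubcylindricalRecognition` (stmt-SmoothPoincare4-10869): the elementary middle step
of the blow-up at the first singular time (Hamilton 1995, §16; Topping 2006, §7.3: "pick
`(pᵢ, tᵢ)` to maximise `|Rm|` over `M × [0, T - 1/i]`").

## What

Given a maximal Ricci flow `(g, cov)` of Riemannian metrics on `M × [0, T)` (`IsMaximalRicciFlow`)
on a closed manifold whose curvature blows up at `T` (for every `C` there is `t₀ < T` with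
`¬ CurvatureBoundedBy (g t) (cov t) C` for all `t ∈ [t₀, T)`), we produce for every `k : ℕ` a time
`t_k ∈ [0, T)`, a constant `Q_k > 0` bounding `|Rm|` on `M × [0, t_k]` in the frame sense of
`CurvatureBoundedBy`, and a point `x_k` carrying a `g(t_k)`-unit-bounded quadruple on which
`|Rm| ≥ Q_k / 2`, with `Q_k t_k ≥ k` (`stub_pointPicking`, with the registered signature; the
per-`k` statement is `exists_pointPick`, for any model).

## Proof (fact-free)

Fix `k`. By `IsRicciFlow.exists_curvatureBoundedBy_Icc` the curvature is bounded by some `K₀ ≥ 0`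
on `M × [0, T/2]`. Put `C := max (2K₀) (2k/T) + 1`; by blow-up there are a time `t' ∈ [0, T)` and a
unit-bounded quadruple at time `t'` with `|Rm| > C`. Again by `exists_curvatureBoundedBy_Icc` the
set `V` of the values `|Rm_t(x)(X, Y, Z, W)|`, `t ∈ [0, t']`, `X, …, W` unit-bounded for `g(t)`, is
bounded above; its supremum `Q` satisfies `Q > C > 0`, bounds `|Rm|` on `M × [0, t']`
(`le_csSup`), and is almost attained: some value at a time `t₁ ≤ t'` exceeds `Q / 2`
(`exists_lt_of_lt_csSup`). As `Q/2 > C/2 > K₀`, necessarily `t₁ > T/2`, so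
`Q t₁ ≥ C · T/2 ≥ k`. Output `(t₁, Q, x₁)` and the quadruple.

## References

* [Hamilton1995] R. S. Hamilton, *The formation of singularities in the Ricci flow*, Surveys in
  Differential Geometry II, International Press 1995, 7–136, §16.
* [Topping2006] P. Topping, *Lectures on the Ricci flow*, LMS Lecture Note Series 325, Cambridge
  Univ. Press 2006, §7.3.
-/

noncomputable section

open scoped Manifold ContDiff Topology ENNReal NNReal ContinuousMap
open Set MeasureTheory
open Literature.Geometry.Lorentzian Literature.Geometry.Riemannian

namespace Summit.SmoothPoincare4.SmoothPoincare4.Theorems.SubcylindricalRecognition.AncientSphereRigidity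

/-- **Point picking, one index** (Topping 2006, §7.3; Hamilton 1995, §16). For a maximal Ricci
flow of Riemannian metrics on `[0, T)` on a compact manifold with curvature blow-up at `T` and
`k : ℕ`: there are `t ∈ [0, T)`, `Q > 0` with `k ≤ Q t`, `|Rm| ≤ Q` on `M × [0, t]`
(`CurvatureBoundedBy`), and a `g(t)`-unit-bounded quadruple at a point `x` with `|Rm| ≥ Q / 2`.
[cite: Topping2006, §7.3] -/
theorem exists_pointPick {E : Type*} [NormedAddCommGroup E] [NormedSpace ℝ E] {H : Type*}
    [TopologicalSpace H] {I : ModelWithCorners ℝ E H} {M : Type*} [TopologicalSpace M]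
    [ChartedSpace H M] [IsManifold I ∞ M] [FiniteDimensional ℝ E] [CompleteSpace E] [T2Space M]
    [CompactSpace M] {g : ℝ → PseudoRiemannianMetric I ∞ E (TangentSpace I : M → Type _)}
    {cov : ℝ → CovariantDerivative I E (TangentSpace I : M → Type _)} {T : ℝ}
    (hmax : IsMaximalRicciFlow g cov T)
    (hblow : ∀ C : ℝ, ∃ t₀ ∈ Ico 0 T, ∀ t ∈ Ico t₀ T, ¬ CurvatureBoundedBy (g t) (cov t) C)
    (k : ℕ) :
    ∃ (t Q : ℝ) (x : M), t ∈ Ico 0 T ∧ 0 < Q ∧ (k : ℝ) ≤ Q * t ∧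
      (∀ s ∈ Icc 0 t, CurvatureBoundedBy (g s) (cov s) Q) ∧
      ∃ X Y Z W : TangentSpace I x, (g t).val x X X ≤ 1 ∧ (g t).val x Y Y ≤ 1 ∧
        (g t).val x Z Z ≤ 1 ∧ (g t).val x W W ≤ 1 ∧
        Q / 2 ≤ |(g t).curvatureForm (cov t) x X Y Z W| := by
  have hT : 0 < T := hmax.pos
  -- (1) a bound `K₀ ≥ 0` on `M × [0, T/2]`
  obtain ⟨K₀', hK₀'⟩ :=
    hmax.isRicciFlow.exists_curvatureBoundedBy_Icc hmax.isRiemannian (half_lt_self hT)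
  obtain ⟨K₀, hK₀nn, hK₀⟩ : ∃ K₀ : ℝ, 0 ≤ K₀ ∧ ∀ t ∈ Icc 0 (T / 2),
      CurvatureBoundedBy (g t) (cov t) K₀ :=
    ⟨max K₀' 0, le_max_right _ _, fun t ht ↦ (hK₀' t ht).mono (le_max_left _ _)⟩
  -- (2) a violating quadruple for the threshold `C := max (2 K₀) (2 k / T) + 1`
  obtain ⟨C, hCK, hCk⟩ : ∃ C : ℝ, 2 * K₀ < C ∧ 2 * k / T < C :=
    ⟨max (2 * K₀) (2 * k / T) + 1, by linarith [le_max_left (2 * K₀) (2 * k / T)],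
      by linarith [le_max_right (2 * K₀) (2 * k / T)]⟩
  have hCpos : 0 < C := by linarith
  obtain ⟨t', ht', hviol⟩ := hblow C
  have hnot : ¬ CurvatureBoundedBy (g t') (cov t') C := hviol t' ⟨le_rfl, ht'.2⟩
  simp only [CurvatureBoundedBy] at hnot
  push Not at hnot
  obtain ⟨x, X, Y, Z, W, hX, hY, hZ, hW, hbig⟩ := hnot
  -- (3) the supremum `Q` of `|Rm|` over unit-bounded quadruples on `M × [0, t']`
  obtain ⟨K, hK⟩ := hmax.isRicciFlow.exists_curvatureBoundedBy_Icc hmax.isRiemannian ht'.2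
  set V : Set ℝ := {v | ∃ t ∈ Icc 0 t', ∃ (y : M) (X' Y' Z' W' : TangentSpace I y),
    (g t).val y X' X' ≤ 1 ∧ (g t).val y Y' Y' ≤ 1 ∧ (g t).val y Z' Z' ≤ 1 ∧
      (g t).val y W' W' ≤ 1 ∧ v = |(g t).curvatureForm (cov t) y X' Y' Z' W'|}
  have hmemV : ∀ t ∈ Icc 0 t', ∀ (y : M) (X' Y' Z' W' : TangentSpace I y),
      (g t).val y X' X' ≤ 1 → (g t).val y Y' Y' ≤ 1 → (g t).val y Z' Z' ≤ 1 →
      (g t).val y W' W' ≤ 1 → |(g t).curvatureForm (cov t) y X' Y' Z' W'| ∈ V :=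
    fun t ht y X' Y' Z' W' hX' hY' hZ' hW' ↦ ⟨t, ht, y, X', Y', Z', W', hX', hY', hZ', hW', rfl⟩
  have hVbdd : BddAbove V := by
    refine ⟨K, ?_⟩
    rintro v ⟨t, ht, y, X', Y', Z', W', hX', hY', hZ', hW', rfl⟩
    exact hK t ht y X' Y' Z' W' hX' hY' hZ' hW'
  have hv₀ : |(g t').curvatureForm (cov t') x X Y Z W| ∈ V :=
    hmemV t' ⟨ht'.1, le_rfl⟩ x X Y Z W hX hY hZ hW
  set Q : ℝ := sSup V
  have hCQ : C < Q := hbig.trans_le (le_csSup hVbdd hv₀)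
  have hQpos : 0 < Q := hCpos.trans hCQ
  have hbound : ∀ s ∈ Icc 0 t', CurvatureBoundedBy (g s) (cov s) Q :=
    fun s hs y X' Y' Z' W' hX' hY' hZ' hW' ↦
      le_csSup hVbdd (hmemV s hs y X' Y' Z' W' hX' hY' hZ' hW')
  obtain ⟨v, hvV, hQv⟩ := exists_lt_of_lt_csSup ⟨_, hv₀⟩ (half_lt_self hQpos)
  obtain ⟨t₁, ht₁, x₁, X₁, Y₁, Z₁, W₁, hX₁, hY₁, hZ₁, hW₁, rfl⟩ := hvV
  -- (4) `T/2 < t₁`, whence `k ≤ Q t₁`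
  have ht₁T : T / 2 < t₁ := by
    by_contra hle
    push Not at hle
    have h₁ : |(g t₁).curvatureForm (cov t₁) x₁ X₁ Y₁ Z₁ W₁| ≤ K₀ :=
      hK₀ t₁ ⟨ht₁.1, hle⟩ x₁ X₁ Y₁ Z₁ W₁ hX₁ hY₁ hZ₁ hW₁
    linarith
  have hk : (k : ℝ) ≤ Q * t₁ := by
    have h₁ : 2 * (k : ℝ) / T * (T / 2) = k := by
      field_simp
    calc (k : ℝ) = 2 * (k : ℝ) / T * (T / 2) := h₁.symm
      _ ≤ Q * (T / 2) := mul_le_mul_of_nonneg_right (hCk.trans hCQ).le (by linarith)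
      _ ≤ Q * t₁ := mul_le_mul_of_nonneg_left ht₁T.le hQpos.le
  -- (5) output
  exact ⟨t₁, Q, x₁, ⟨ht₁.1, ht₁.2.trans_lt ht'.2⟩, hQpos, hk,
    fun s hs ↦ hbound s ⟨hs.1, hs.2.trans ht₁.2⟩, X₁, Y₁, Z₁, W₁, hX₁, hY₁, hZ₁, hW₁, hQv.le⟩

/-- **Point picking** (Hamilton 1995, §16; Topping 2006, §7.3), the registered stub
`stub_pointPicking` of line `ancient-sphere-rigidity`: for a maximal Ricci flow `(g, cov)` on a
closed 4-manifold with curvature blow-up at `T`, sequences `t_k ∈ [0, T)`, `Q_k > 0`, `x_k` with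
`Q_k t_k ≥ k`, `|Rm| ≤ Q_k` on `M × [0, t_k]`, and a `g(t_k)`-unit-bounded quadruple at `x_k`
with `|Rm| ≥ Q_k / 2` (from `exists_pointPick` by choice). [cite: Topping2006, §7.3] -/
theorem stub_pointPicking :
    ∀ (M : Type) [TopologicalSpace M] [T2Space M] [SecondCountableTopology M]
      [ChartedSpace (EuclideanSpace ℝ (Fin 4)) M] [IsManifold (𝓡 4) ∞ M] [CompactSpace M]
      [ConnectedSpace M] [T3Space M] [MeasurableSpace M] [BorelSpace M] (T : ℝ)
      (g : ℝ → PseudoRiemannianMetric (𝓡 4) ∞ (EuclideanSpace ℝ (Fin 4)) (TangentSpace (𝓡 4) : M → Type _))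
      (cov : ℝ → CovariantDerivative (𝓡 4) (EuclideanSpace ℝ (Fin 4)) (TangentSpace (𝓡 4) : M → Type _)),
      IsMaximalRicciFlow g cov T →
      (∀ C : ℝ, ∃ t₀ ∈ Set.Ico 0 T, ∀ t ∈ Set.Ico t₀ T, ¬ CurvatureBoundedBy (g t) (cov t) C) →
      ∃ (tk Qk : ℕ → ℝ) (xk : ℕ → M),
        (∀ k, tk k ∈ Set.Ico 0 T) ∧ (∀ k, 0 < Qk k) ∧ (∀ k : ℕ, (k : ℝ) ≤ Qk k * tk k) ∧
        (∀ k, ∀ t ∈ Set.Icc 0 (tk k), CurvatureBoundedBy (g t) (cov t) (Qk k)) ∧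
        (∀ k, ∃ X Y Z W : TangentSpace (𝓡 4) (xk k),
          (g (tk k)).val (xk k) X X ≤ 1 ∧ (g (tk k)).val (xk k) Y Y ≤ 1 ∧
          (g (tk k)).val (xk k) Z Z ≤ 1 ∧ (g (tk k)).val (xk k) W W ≤ 1 ∧
          Qk k / 2 ≤ |(g (tk k)).curvatureForm (cov (tk k)) (xk k) X Y Z W|) := by
  intro M _ _ _ _ _ _ _ _ _ _ T g cov hmax hblow
  choose tk Qk xk htk hQk hk hbd hquad using exists_pointPick hmax hblow
  exact ⟨tk, Qk, xk, htk, hQk, hk, hbd, hquad⟩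

end Summit.SmoothPoincare4.SmoothPoincare4.Theorems.SubcylindricalRecognition.AncientSphereRigidity
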